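import Summits.CriticalPhenomena.PercolationContinuityZ3.Theorems.PercNearOneGluingAdditiveGluingSetObserverUnfold
import Summits.CriticalPhenomena.PercolationContinuityZ3.Theorems.PercNearOneGluingNoHeavyLowerTailMixCSHUnfoldMain
import HarnessLib

/-!
# Conjecture G / SET-W via a SET observer, XV: LEMMA U-set assembled — the within-margin of the set hierarchy is `≥` H-part-set `+`
# the lower-level margins (the hypothesis `hU` of `CSHSet.cshSetHolds_of_unfold` modulo Lemma H-set)

Support file (`--supports stmt-CriticalPhenomena-4576`); no definitions, no named facts, no sorries.  Seat (b) V⁺-form `png-dp-vplus`, gen 13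
(memo MEMO-gen12.md §4(b)–(e), §10 (U)).  Set-slot version of prim-ineq-prove-1's `…NoHeavyLowerTailCSHUnfoldMain.lean`.
* `within_unfold_ge` — LEMMA U-set: for weights `< 1`, owner `x`, avoided set `Y`, distinct decoys `D` off `x, Y, v, O`, any `p` and any monotone
  `g`, the `{x↮Y}`-integral of the margin `Marg[s ↦ Cov_{w^ω}(g(C_x), 1_{Ev ω s})]` (slots `Option V`: `none` = the observer SET `O` with the
  liveness factor `1{O ∩ V(C_Y) = ∅}`, `some u` = `{x ↔ u}`; the slot events are abstracted as `Ev` with two indicator hypotheses, so that the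
  `match`-events of `…SetObserverInduction.lean` can be plugged in by unification) is AT LEAST
  `Σ_ω w 1{x↮Y} [1{O live}·Cov_world(g, 1{O ~ {x}∪D}) − p·Cov_world(g, 1{v ↔ {x}∪D})] + (subTO(none) − p·subTO(some v))` (sum vocabulary
  `CSH.wcovOff`; an inequality because of the defect of the set slot, `…SetObserverUnfoldDecoy`).
* `subTO_comb_nonneg` — `subTO(none) − p·subTO(some v) = Σ_j μ(E_j)⁻¹·cshMarginSet(Y_j; d_j; D_{>j}; O, v)[Φ̃_j] ≥ 0` from the lower levels.
* **`within_nonneg_of_hpart_set`** — the step `hU` of `CSHSet.cshSetHolds_of_unfold` GIVEN the H-part-set (in sum form) and the lower levels.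
[cite: VandenbergHaggstromKahn2005, §2.1 Lemma 2.4 (p. 10); §1 display (10) (pp. 7–8) — corollaries] [cite: KozmaNitzan2024, Conj. 4 (p. 32)]
-/

noncomputable section

namespace Summit.CriticalPhenomena.PercolationContinuityZ3.Theorems

open MeasureTheory Set Literature.Probability.LatticeModels Literature.Probability.Percolation
open scoped Classical

namespace CSHSet

open CSH HullPort BHK2006 DecisionTree

variable {V : Type*}

/-! ### Small dictionary -/

/-- The slot test functions of the set hierarchy in a world, read through the abstract slot events `Ev`, are `jnO_{x}`:
`s ↦ 1_{Ev ω s}(ζ) = jnO R_ζ O ℓ(ω) {x} s` when `1_{Ev ω none} = ℓ(ω)·1{O ~ x}` and `Ev ω (some u) = {x ↔ u}`. [folklore] -/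
theorem ind_slotEv_eq_jnO (O : Finset V) (Y : Set V) (x : V) (Ev : Set (Sym2 V) → Option V → Set (Set (Sym2 V)))
    (hEv0 : ∀ ω ζ, ind (Ev ω none) ζ = ind {β : Set (Sym2 V) | ∀ o ∈ O, β ∈ avoidEv o Y} ω *
      ind {ζ' : Set (Sym2 V) | ∃ o ∈ O, (openGraph ζ').Reachable o x} ζ)
    (hEv1 : ∀ ω u, Ev ω (some u) = (openConn x u : Set (BondConfig V))) (ω ζ : Set (Sym2 V)) :
    (fun s => ind (Ev ω s) ζ) = jnO (openGraph ζ).Reachable O (ind {β : Set (Sym2 V) | ∀ o ∈ O, β ∈ avoidEv o Y} ω) {x} := by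
  funext s
  cases s with
  | none =>
    rw [hEv0, jnO_none]
    congr 1
    by_cases h : ∃ o ∈ O, (openGraph ζ).Reachable o x
    · rw [ind_of_mem (show ζ ∈ {ζ' : Set (Sym2 V) | ∃ o ∈ O, (openGraph ζ').Reachable o x} from h), if_pos]
      obtain ⟨o, ho, hox⟩ := h
      exact ⟨o, ho, x, rfl, hox⟩
    · rw [ind_of_not_mem (show ζ ∉ {ζ' : Set (Sym2 V) | ∃ o ∈ O, (openGraph ζ').Reachable o x} from h), if_neg]
      rintro ⟨o, ho, s, hs, hos⟩
      rw [Set.mem_singleton_iff] at hs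
      subst hs
      exact h ⟨o, ho, hos⟩
  | some u =>
    rw [hEv1, jnO_some, jn_singleton, chi_reachable_eq_ind]

variable [Fintype V]

/-- **Exchange of the margin and the world covariance** (both linear): `Marg[s ↦ Cov(G, φ_s)] = Cov(G, ζ ↦ Marg[s ↦ φ_s(ζ)])`. [folklore] -/
theorem cshMarg_wcovOff_exchange (w : Sym2 V → ℝ) (Y : Set V) (G : Set (Sym2 V) → ℝ) (L : List (Option V × (Option V → ℝ)))
    (p : ℝ) (o v : Option V) (φ : Option V → Set (Sym2 V) → ℝ) (ω : Set (Sym2 V)) :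
    cshMarg L p o v (fun s => wcovOff w Y G (φ s) ω) = wcovOff w Y G (fun ζ => cshMarg L p o v (fun s => φ s ζ)) ω := by
  rw [cshMarg_eq_sum_single, wcovOff_finset_sum]
  congr 1
  funext ζ
  rw [cshMarg_eq_sum_single L p o v (fun s => φ s ζ)]

/-! ### The main inequality -/

/-- **LEMMA U FOR A SET OBSERVER** (memo §4(b),(c); set version of `CSH.within_unfold`, now an INEQUALITY because of the defect of the set slot):
the `{x↮Y}`-integral of the margin of the world covariances `s ↦ Cov_{w^ω}(g(C_x), 1_{Ev ω s})` — the integrand of the hypothesis `hU` of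
`CSHSet.cshSetHolds_of_unfold`, with the slot events abstracted as `Ev` (`1_{Ev ω none} = 1{O live in ω}·1{O ~ x}`, `Ev ω (some u) = {x ↔ u}`) —
is AT LEAST the H-part `∫_{x↮Y} [1{O live}·Cov_{w^ω}(g, 1{O ~ S}) − p·Cov_{w^ω}(g, 1{v ↔ S})]`, `S = {x} ∪ D`, plus `subTO(none) − p·subTO(some v)`.
(transcription of the cell memo png-dp-vplus MEMO-gen12.md §4(b),(c))
[cite: VandenbergHaggstromKahn2005, §2.1 Lemma 2.4 (p. 10); §1 display (10) (pp. 7–8) — corollaries] [cite: KozmaNitzan2024, Conj. 4 (p. 32)] -/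
theorem within_unfold_ge (w : Sym2 V → unitInterval) (hw : ∀ e, w e < 1) (x : V) (Y : Set V) (D : List V) (O : Finset V) (v : V)
    (hnd : D.Nodup) (hD : ∀ d ∈ D, d ≠ x ∧ d ∉ Y ∧ d ≠ v ∧ d ∉ O) (g : Set (Sym2 V) → ℝ) (hg : Monotone g) (p : ℝ)
    (Ev : Set (Sym2 V) → Option V → Set (Set (Sym2 V)))
    (hEv0 : ∀ ω ζ, ind (Ev ω none) ζ = ind {β : Set (Sym2 V) | ∀ o ∈ O, β ∈ avoidEv o Y} ω *
      ind {ζ' : Set (Sym2 V) | ∃ o ∈ O, (openGraph ζ').Reachable o x} ζ)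
    (hEv1 : ∀ ω u, Ev ω (some u) = (openConn x u : Set (BondConfig V))) :
    (∑ ω, weight (fun e => (w e : ℝ)) ω * (ind (avoidEv x Y) ω *
        (ind {β : Set (Sym2 V) | ∀ o ∈ O, β ∈ avoidEv o Y} ω *
            wcovOff (fun e => (w e : ℝ)) Y (fun β => g (openEdgeCluster β x))
              (ind {ζ' : Set (Sym2 V) | ∃ o ∈ O, ∃ t ∈ insert x D.toFinset, (openGraph ζ').Reachable o t}) ω -
          p * wcovOff (fun e => (w e : ℝ)) Y (fun β => g (openEdgeCluster β x))
              (ind (⋃ t ∈ insert x D.toFinset, (openConn v t : Set (BondConfig V)))) ω))) +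
      (subTO w x Y g O none {x} D - p * subTO w x Y g O (some v) {x} D) ≤
    ∫ ω in {ω : BondConfig V | ∀ y ∈ Y, ¬ (openGraph ω).Reachable x y},
        cshMarg (decoyListSet w O (insert x Y) D) p none (some v)
          (fun s => (∫ η in Ev ω s, g (openEdgeCluster η x)
                ∂(prodBernoulli fun e => if (∃ z ∈ e, ∃ y ∈ Y, (openGraph ω).Reachable y z)
                  then (0 : unitInterval) else w e)) -
              (∫ η, g (openEdgeCluster η x)
                ∂(prodBernoulli fun e => if (∃ z ∈ e, ∃ y ∈ Y, (openGraph ω).Reachable y z)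
                  then (0 : unitInterval) else w e)) *
              (prodBernoulli fun e => if (∃ z ∈ e, ∃ y ∈ Y, (openGraph ω).Reachable y z)
                  then (0 : unitInterval) else w e).real (Ev ω s))
        ∂(prodBernoulli w) := by
  classical
  set ŵ : Sym2 V → ℝ := fun e => (w e : ℝ) with hŵ
  have hm : ∑ ω, weight ŵ ω = 1 := by
    have h1 := integral_prodBernoulli_eq_sum w fun _ => (1 : ℝ)
    simp only [integral_const, probReal_univ, smul_eq_mul, mul_one] at h1
    exact h1.symm
  set L := decoyListSet w O (insert x Y) D with hLdef
  set G : Set (Sym2 V) → ℝ := fun β => g (openEdgeCluster β x) with hG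
  set ℓ : Set (Sym2 V) → ℝ := fun ω => ind {β : Set (Sym2 V) | ∀ o ∈ O, β ∈ avoidEv o Y} ω with hℓ
  have hDev : {ω : BondConfig V | ∀ y ∈ Y, ¬ (openGraph ω).Reachable x y} = avoidEv x Y := rfl
  have hL' : L = decoyListSet w O ({x} ∪ Y) D := by rw [hLdef, ← Set.insert_eq]
  have hheads : ∀ dc ∈ L, ∃ d, dc.1 = some d := decoyListSet_heads w O (insert x Y) D
  have hdecs : {d : V | some d ∈ L.map Prod.fst} = {d | d ∈ D} := decoys_decoyListSet w O (insert x Y) D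
  set Sset : Set V := {x} ∪ {d | d ∈ D} with hSset
  have hSfin : (↑(insert x D.toFinset) : Set V) = Sset := by
    ext u; simp [hSset]
  -- the liveness factor as a function of the cluster of `Y`
  set ℓW : Set (Sym2 V) → ℝ := fun W => ind {β : Set (Sym2 V) | ∀ o ∈ O, ¬ (o ∈ Y ∨ ∃ e ∈ W, o ∈ e)} W with hℓW
  have hℓW' : ∀ ζ' : Set (Sym2 V), ℓW (setCl ζ' Y) = ind {β : Set (Sym2 V) | ∀ o ∈ O, β ∈ avoidEv o Y} ζ' := by
    intro ζ'
    simp only [hℓW]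
    by_cases h : ∀ o ∈ O, ζ' ∈ avoidEv o Y
    · rw [ind_of_mem (show ζ' ∈ {β : Set (Sym2 V) | ∀ o ∈ O, β ∈ avoidEv o Y} from h), ind_of_mem]
      exact fun o ho => (mem_avoidEv_iff_notMem_span o Y ζ').1 (h o ho)
    · rw [ind_of_not_mem (show ζ' ∉ {β : Set (Sym2 V) | ∀ o ∈ O, β ∈ avoidEv o Y} from h), ind_of_not_mem]
      exact fun h' => h fun o ho => (mem_avoidEv_iff_notMem_span o Y ζ').2 (h' o ho)
  have hℓeq : ∀ ω, ℓ ω = ℓW (setCl ω Y) := fun ω => by rw [hℓW' ω]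
  -- the world test functions
  set Jf : Set (Sym2 V) → Option V → Set (Sym2 V) → ℝ := fun ω s ζ => jnO (openGraph ζ).Reachable O (ℓ ω) Sset s with hJf
  set Tf : Set (Sym2 V) → Option V → Set (Sym2 V) → ℝ := fun ω s ζ =>
    unfoldTO (openGraph ζ).Reachable O (ℓW (setCl ω Y)) {x} L s with hTf
  -- Step A: the integrand is a world covariance margin (sum vocabulary)
  rw [hDev, setIntegral_eq_sum_ind]
  simp only [world_cov_eq_wcovOff]
  -- Step B: pointwise unfolding of the margin of the world covariances
  have stepB : ∀ ω, cshMarg L p none (some v) (fun s => wcovOff ŵ Y G (ind (Ev ω s)) ω) =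
      wcovOff ŵ Y G (Jf ω none) ω - p * wcovOff ŵ Y G (Jf ω (some v)) ω - wcovOff ŵ Y G (Tf ω none) ω +
        p * wcovOff ŵ Y G (Tf ω (some v)) ω := by
    intro ω
    rw [cshMarg_wcovOff_exchange ŵ Y G L p none (some v) (fun s ζ => ind (Ev ω s) ζ) ω]
    have inner : (fun ζ => cshMarg L p none (some v) (fun s => ind (Ev ω s) ζ)) =
        fun ζ => (Jf ω none ζ - p * Jf ω (some v) ζ) - (Tf ω none ζ - p * Tf ω (some v) ζ) +
          (unfoldK L none - p * unfoldK L (some v)) := by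
      funext ζ
      rw [ind_slotEv_eq_jnO O Y x Ev hEv0 hEv1 ω ζ]
      simp only [cshMarg, slForm_jnO (openGraph ζ).Reachable O (ind {β : Set (Sym2 V) | ∀ o ∈ O, β ∈ avoidEv o Y} ω)
        (fun a b h => h.symm) (fun a b c h h' => h.trans h') L hheads {x}, hdecs, hJf, hTf, hSset, hℓ, hℓW' ω]
      ring
    rw [inner, wcovOff_affine ŵ hm]
  -- Step C: sum over ω; the `unfoldTO` parts against `−subTO`
  have hDn : ∀ d ∈ D, d ∉ ({x} : Set V) ∧ d ∉ Y ∧ some d ≠ (none : Option V) ∧ d ∉ O := fun d hd =>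
    ⟨fun h => (hD d hd).1 (Set.mem_singleton_iff.1 h), (hD d hd).2.1, Option.some_ne_none d, (hD d hd).2.2.2⟩
  have hDv : ∀ d ∈ D, d ∉ ({x} : Set V) ∧ d ∉ Y ∧ d ≠ v ∧ d ∉ O := fun d hd =>
    ⟨fun h => (hD d hd).1 (Set.mem_singleton_iff.1 h), (hD d hd).2.1, (hD d hd).2.2.1, (hD d hd).2.2.2⟩
  have stepCn := sum_wcov_unfoldTO_le w hw x Y g hg O none ℓW hℓW' D {x} (Set.mem_singleton x) hnd hDn
  have stepCv := sum_wcov_unfoldTO_some w hw x Y g O v ℓW hℓW' D {x} (Set.mem_singleton x) hnd hDv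
  rw [← hL'] at stepCn stepCv
  have e : ∀ ω, weight ŵ ω * (ind (avoidEv x Y) ω *
      cshMarg L p none (some v) (fun s => wcovOff ŵ Y G (ind (Ev ω s)) ω)) =
      weight ŵ ω * (ind (avoidEv x Y) ω * (wcovOff ŵ Y G (Jf ω none) ω - p * wcovOff ŵ Y G (Jf ω (some v)) ω)) -
        weight ŵ ω * (ind (avoidEv x Y) ω * wcovOff ŵ Y G (Tf ω none) ω) +
        p * (weight ŵ ω * (ind (avoidEv x Y) ω * wcovOff ŵ Y G (Tf ω (some v)) ω)) := by
    intro ω; rw [stepB ω]; ring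
  rw [Finset.sum_congr rfl (fun ω _ => e ω), Finset.sum_add_distrib, Finset.sum_sub_distrib, ← Finset.mul_sum]
  change _ ≤ (∑ ω, weight ŵ ω * (ind (avoidEv x Y) ω * (wcovOff ŵ Y G (Jf ω none) ω - p * wcovOff ŵ Y G (Jf ω (some v)) ω))) -
      (∑ ω, weight ŵ ω * (ind (avoidEv x Y) ω * wcovOff ŵ Y G
        (fun ζ => unfoldTO (openGraph ζ).Reachable O (ℓW (setCl ω Y)) {x} L none) ω)) +
      p * (∑ ω, weight ŵ ω * (ind (avoidEv x Y) ω * wcovOff ŵ Y G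
        (fun ζ => unfoldTO (openGraph ζ).Reachable O (ℓW (setCl ω Y)) {x} L (some v)) ω))
  rw [stepCv]
  -- Step D: the H-part test functions
  have hJn : ∀ ω, Jf ω none = fun ζ => ℓ ω *
      ind {ζ' : Set (Sym2 V) | ∃ o ∈ O, ∃ t ∈ insert x D.toFinset, (openGraph ζ').Reachable o t} ζ := by
    intro ω; funext ζ
    rw [hJf]
    dsimp only
    rw [jnO_none]
    congr 1
    have hiff : (∃ o ∈ O, ∃ s ∈ Sset, (openGraph ζ).Reachable o s) ↔
        ζ ∈ {ζ' : Set (Sym2 V) | ∃ o ∈ O, ∃ t ∈ insert x D.toFinset, (openGraph ζ').Reachable o t} := by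
      rw [← hSfin]
      simp only [Finset.mem_coe, Set.mem_setOf_eq]
    by_cases h : ∃ o ∈ O, ∃ s ∈ Sset, (openGraph ζ).Reachable o s
    · rw [if_pos h, ind_of_mem (hiff.1 h)]
    · rw [if_neg h, ind_of_not_mem (fun h' => h (hiff.2 h'))]
  have hJv : ∀ ω, Jf ω (some v) = ind (⋃ t ∈ insert x D.toFinset, (openConn v t : Set (BondConfig V))) := by
    intro ω; funext ζ
    rw [hJf]
    dsimp only
    rw [jnO_some, jn_reachable_eq_ind, ← setOf_exists_reachable_eq_iUnion, hSfin]
  have eH : ∀ ω, weight ŵ ω * (ind (avoidEv x Y) ω * (wcovOff ŵ Y G (Jf ω none) ω - p * wcovOff ŵ Y G (Jf ω (some v)) ω)) =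
      weight ŵ ω * (ind (avoidEv x Y) ω *
        (ℓ ω * wcovOff ŵ Y G (ind {ζ' : Set (Sym2 V) | ∃ o ∈ O, ∃ t ∈ insert x D.toFinset, (openGraph ζ').Reachable o t}) ω -
          p * wcovOff ŵ Y G (ind (⋃ t ∈ insert x D.toFinset, (openConn v t : Set (BondConfig V)))) ω)) := by
    intro ω; rw [hJn ω, hJv ω, MixCSH.wcovOff_const_mul]
  rw [Finset.sum_congr rfl (fun ω _ => eH ω)]
  linarith [stepCn]

/-! ### The lower-level terms are nonnegative given the lower levels -/

/-- **`subTO(none) − p·subTO(some v) ≥ 0` from the lower levels** (set version of `CSH.subT_comb_nonneg`): along the splittings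
`D₀ = pre ++ rest`, with the source set `S = {x} ∪ pre`, `subTO_S(rest)(none) − p·subTO_S(rest)(some v) = Σ_{d ∈ rest} μ(E_d)⁻¹ ·
cshMarginSet w d ({x}∪Y∪pre_d) rest_{>d} O v Φ̃_d`, each term nonnegative when the lower-level margins are (hypothesis `hIH`, the induction
hypothesis of `CSHSet.cshMarginSet_nonneg_of_unfold`) and `p = obsConstSet w O v ({x} ∪ Y ∪ D₀)`.
(transcription of the cell memo png-dp-vplus MEMO-gen12.md §4(e)) [cite: KozmaNitzan2024, Conj. 4 (p. 32)] -/
theorem subTO_comb_nonneg (w : Sym2 V → unitInterval) (x : V) (Y : Set V) (D₀ : List V) (O : Finset V) (v : V)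
    {g : Set (Sym2 V) → ℝ} (hg : Monotone g)
    (hIH : ∀ (pre : List V) (d : V) (ds' : List V), D₀ = pre ++ d :: ds' →
      ∀ h : Set (Sym2 V) → ℝ, Monotone h → (∀ C, 0 ≤ h C) →
        0 ≤ cshMarginSet w d (insert x Y ∪ {e | e ∈ pre}) ds' O v h) :
    ∀ (rest pre : List V), D₀ = pre ++ rest →
      0 ≤ subTO w x Y g O none ({x} ∪ {e | e ∈ pre}) rest -
        obsConstSet w O v (insert x Y ∪ {d | d ∈ D₀}) * subTO w x Y g O (some v) ({x} ∪ {e | e ∈ pre}) rest := by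
  intro rest
  induction rest with
  | nil => intro pre _; simp
  | cons d ds ih =>
    intro pre hsplit
    set A : Set V := {x} ∪ {e | e ∈ pre} ∪ Y with hA
    have hA' : A = insert x Y ∪ {e | e ∈ pre} := by
      ext u; simp only [hA, Set.mem_union, Set.mem_singleton_iff, Set.mem_setOf_eq, Set.mem_insert_iff]; tauto
    have hset : insert d A ∪ {e | e ∈ ds} = insert x Y ∪ {e | e ∈ D₀} := by
      ext u
      simp only [hA, hsplit, Set.mem_union, Set.mem_insert_iff, Set.mem_singleton_iff, Set.mem_setOf_eq, List.mem_append,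
        List.mem_cons]
      tauto
    -- the head term is `μ(E)⁻¹ · cshMarginSet w d A ds O v Φ̃_d ≥ 0`
    have hmargin : slForm (decoyListSet w O (insert d A) ds) (covDSet w d A (phiT w x Y g d) O) none -
        obsConstSet w O v (insert x Y ∪ {e | e ∈ D₀}) *
          slForm (decoyListSet w O (insert d A) ds) (covDSet w d A (phiT w x Y g d) O) (some v) =
        cshMarginSet w d (insert x Y ∪ {e | e ∈ pre}) ds O v (phiT w x Y g d) := by
      rw [← hset, ← hA']; rfl
    have hhead : 0 ≤ cshMarginSet w d (insert x Y ∪ {e | e ∈ pre}) ds O v (phiT w x Y g d) :=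
      hIH pre d ds hsplit (phiT w x Y g d) (phiT_mono w x Y hg d) (fun K => phiFun_nonneg w x Y hg _)
    have hinv : 0 ≤ ((prodBernoulli w).real (avoidEv d A))⁻¹ := inv_nonneg.2 measureReal_nonneg
    -- the tail by induction with `pre ++ [d]`
    have htail := ih (pre ++ [d]) (by rw [hsplit]; simp)
    have hS' : ({x} ∪ {e | e ∈ pre ++ [d]} : Set V) = insert d ({x} ∪ {e | e ∈ pre}) := by
      ext u
      simp only [Set.mem_union, Set.mem_singleton_iff, Set.mem_setOf_eq, List.mem_append, List.mem_singleton, Set.mem_insert_iff]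
      tauto
    rw [hS'] at htail
    have hSY : ({x} ∪ {e | e ∈ pre} : Set V) ∪ Y = A := rfl
    simp only [subTO_cons, hSY]
    have key : ((prodBernoulli w).real (avoidEv d A))⁻¹ *
          slForm (decoyListSet w O (insert d A) ds) (covDSet w d A (phiT w x Y g d) O) none +
        subTO w x Y g O none (insert d ({x} ∪ {e | e ∈ pre})) ds -
        obsConstSet w O v (insert x Y ∪ {d | d ∈ D₀}) *
          (((prodBernoulli w).real (avoidEv d A))⁻¹ *
              slForm (decoyListSet w O (insert d A) ds) (covDSet w d A (phiT w x Y g d) O) (some v) +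
            subTO w x Y g O (some v) (insert d ({x} ∪ {e | e ∈ pre})) ds) =
        ((prodBernoulli w).real (avoidEv d A))⁻¹ * cshMarginSet w d (insert x Y ∪ {e | e ∈ pre}) ds O v (phiT w x Y g d) +
          (subTO w x Y g O none (insert d ({x} ∪ {e | e ∈ pre})) ds -
            obsConstSet w O v (insert x Y ∪ {d | d ∈ D₀}) * subTO w x Y g O (some v) (insert d ({x} ∪ {e | e ∈ pre})) ds) := by
      rw [← hmargin]; ring
    rw [key]
    exact add_nonneg (mul_nonneg hinv hhead) htail

/-- **The within-margin of the set hierarchy is nonnegative given the lower levels and the H-part** — the hypothesis `hU` of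
`CSHSet.cshSetHolds_of_unfold` (slot events abstracted as `Ev`) modulo LEMMA H-set (`hHP`: the H-part with the liveness factor and
`p = obsConstSet w O v ({x}∪Y∪D)` is nonnegative) and the lower-level margins (`hIH`).  Weights `< 1`.
(transcription of the cell memo png-dp-vplus MEMO-gen12.md §4(e)) [cite: KozmaNitzan2024, Conj. 4 (p. 32)] -/
theorem within_nonneg_of_hpart_set (w : Sym2 V → unitInterval) (hw : ∀ e, w e < 1) (x : V) (Y : Set V) (D : List V) (O : Finset V)
    (v : V) (hnd : D.Nodup) (hD : ∀ d ∈ D, d ≠ x ∧ d ∉ Y ∧ d ≠ v ∧ d ∉ O) {g : Set (Sym2 V) → ℝ} (hg : Monotone g)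
    (Ev : Set (Sym2 V) → Option V → Set (Set (Sym2 V)))
    (hEv0 : ∀ ω ζ, ind (Ev ω none) ζ = ind {β : Set (Sym2 V) | ∀ o ∈ O, β ∈ avoidEv o Y} ω *
      ind {ζ' : Set (Sym2 V) | ∃ o ∈ O, (openGraph ζ').Reachable o x} ζ)
    (hEv1 : ∀ ω u, Ev ω (some u) = (openConn x u : Set (BondConfig V)))
    (hIH : ∀ (pre : List V) (d : V) (ds' : List V), D = pre ++ d :: ds' →
      ∀ h : Set (Sym2 V) → ℝ, Monotone h → (∀ C, 0 ≤ h C) →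
        0 ≤ cshMarginSet w d (insert x Y ∪ {e | e ∈ pre}) ds' O v h)
    (hHP : 0 ≤ ∑ ω, weight (fun e => (w e : ℝ)) ω * (ind (avoidEv x Y) ω *
        (ind {β : Set (Sym2 V) | ∀ o ∈ O, β ∈ avoidEv o Y} ω *
            wcovOff (fun e => (w e : ℝ)) Y (fun β => g (openEdgeCluster β x))
              (ind {ζ' : Set (Sym2 V) | ∃ o ∈ O, ∃ t ∈ insert x D.toFinset, (openGraph ζ').Reachable o t}) ω -
          obsConstSet w O v (insert x Y ∪ {d | d ∈ D}) * wcovOff (fun e => (w e : ℝ)) Y (fun β => g (openEdgeCluster β x))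
              (ind (⋃ t ∈ insert x D.toFinset, (openConn v t : Set (BondConfig V)))) ω))) :
    0 ≤ ∫ ω in {ω : BondConfig V | ∀ y ∈ Y, ¬ (openGraph ω).Reachable x y},
        cshMarg (decoyListSet w O (insert x Y) D) (obsConstSet w O v (insert x Y ∪ {d | d ∈ D})) none (some v)
          (fun s => (∫ η in Ev ω s, g (openEdgeCluster η x)
                ∂(prodBernoulli fun e => if (∃ z ∈ e, ∃ y ∈ Y, (openGraph ω).Reachable y z)
                  then (0 : unitInterval) else w e)) -
              (∫ η, g (openEdgeCluster η x)
                ∂(prodBernoulli fun e => if (∃ z ∈ e, ∃ y ∈ Y, (openGraph ω).Reachable y z)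
                  then (0 : unitInterval) else w e)) *
              (prodBernoulli fun e => if (∃ z ∈ e, ∃ y ∈ Y, (openGraph ω).Reachable y z)
                  then (0 : unitInterval) else w e).real (Ev ω s))
        ∂(prodBernoulli w) := by
  have hmain := within_unfold_ge w hw x Y D O v hnd hD g hg (obsConstSet w O v (insert x Y ∪ {d | d ∈ D})) Ev hEv0 hEv1
  have hsub := subTO_comb_nonneg w x Y D O v hg hIH D [] (by simp)
  have hS0 : ({x} ∪ {e | e ∈ ([] : List V)} : Set V) = {x} := by ext u; simp
  rw [hS0] at hsub
  linarith [hmain, hsub, hHP]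

end CSHSet

end Summit.CriticalPhenomena.PercolationContinuityZ3.Theorems

end
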